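import Summits.Ventures.PercRepro.LemmaBPlusK5Def

/-!
# Faces of `K₅`: kernel slices 44 … 47 (part L)

Each theorem is one `decide +kernel` at default heartbeats (≈ 55 s: the 1024-row table of the marking
plus ≤ 22 000 face points in sub-mask loops); generated by `tools/gen_k5.py`.
-/

namespace PercRepro

namespace Examples

open MultiGraph

/-- Slice 44: joins `u ∈ [1014, 1015)` of the faces of `K₅` (6561 face points). -/
theorem k5_slice_44 : k5.FacesSRange ![0, 1, 2, 3] 1014 1015 := by decide +kernel

/-- Slice 45: joins `u ∈ [1015, 1017)` of the faces of `K₅` (21870 face points). -/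
theorem k5_slice_45 : k5.FacesSRange ![0, 1, 2, 3] 1015 1017 := by decide +kernel

/-- Slice 46: joins `u ∈ [1017, 1019)` of the faces of `K₅` (13122 face points). -/
theorem k5_slice_46 : k5.FacesSRange ![0, 1, 2, 3] 1017 1019 := by decide +kernel

/-- Slice 47: joins `u ∈ [1019, 1020)` of the faces of `K₅` (19683 face points). -/
theorem k5_slice_47 : k5.FacesSRange ![0, 1, 2, 3] 1019 1020 := by decide +kernel

end Examples

end PercRepro
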